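import Summits.NavierStokesRegularity.FluidComputer.PalasekTowerStrainDoorAt
import Summits.NavierStokesRegularity.FluidComputer.PalasekTowerStrainShadowedRunSharp

/-!
# THE STRAIN DOOR AT ARBITRARY RATES `R`, II: the CURRENCY-FREE core (mechanism door + ANY free run shadowing a
# reference with the four readouts ⟹ `EpisodeBaseGAt R`) and the NUMERAL strain certificate (slice constant `9.03`)

Cell `ns-blowup`, seat `ns-palasek-20303-p1` (LEAD prover on stmt-NavierStokesRegularity-20303 `EpisodeBaseT`;
route `PalasekTowerBreakdown`, rev 19; line `straindoor` at `tuned`). Sequel of `PalasekTowerStrainDoorAt.lean` (p528856).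
LABEL: E–C typing (KERNEL: one open `Prop` parametrised by the rates record — the NUMERAL certificate letter — and
sorry-free compositions). WHAT THIS IS NOT: not Navier–Stokes evidence — nothing is inhabited; no run, design or
certificate is exhibited; the numeral certificate is OPEN at `R = tuned`.

* `episodeBaseGAt_of_mechanismDoorAt_of_nearFreeRun` — **THE CURRENCY-FREE CORE at `R`**: the mechanism door at `R`
  (`StrainDoor.MechanismDoorAt R`), the static datum facts (smooth, divergence free, `tsupport U ⊆ B̄(0,ρ)`, speed
  `< Y₀(R)`), ANY classical finite-energy free run `(v', q')` on the shifted window clock `[0, wfirstAt R]` from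
  `v' 0 = U` that stays `δ`-close to a reference field `w` whose slice at `wfirstAt R` is continuous and shows the
  four explicit readouts with margins `η + δ` ⟹ `EpisodeBaseGAt R` (time shift `IsClassicalNSSolutionOn.comp_add_right`
  to `[1, τfirstAt R]`, readout transfer `StrainDoor.faces_of_near`, the door). Every a-posteriori door — strain
  currency route (A) (p526708 / numeral p529071), the `H²`/Agmon route (B), the weighted-vorticity route (C) — plugs
  into this lemma with its own existence-and-closeness output; the composition of p528856 is its instance for p526708.
* `CertificateDataSharp R …` / `CertificateSharpAt R` — **the NUMERAL strain certificate at `R`**: the fields of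
  `StrainDoor.CertificateData R` with the non-numerical Oseen slice constant `C₀ = oseenSliceConst ℝ³` replaced by the
  numeral `9.03` (fc-prover-2 g9, `OseenSliceConstUpperBound`, p525546: `‖N_σ[a,b]‖ ≤ (16/√π) σ^{-1/2} M_a M_b`,
  `16/√π < 9.03`) in the short-window and initial-layer inequalities — EXACTLY the hypotheses of the numeral door
  `StrainShadowSharp.exists_freeRun_near_of_strain` (fc-prover-3 g10, p529071) on `[0, wfirstAt R]` — and the same
  four readouts. Every inequality field is between explicit reals once `(U, w, ϖ, g, Γ)` and the numbers are
  explicit: this is the letter a validated computation checks.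
* `episodeBaseGAt_of_mechanismDoorAt_of_certificateDataSharp` / `…_of_certificateSharpAt` — THE NUMERAL COMPOSITION
  `MechanismDoorAt R → CertificateSharpAt R → EpisodeBaseGAt R` (the shape of skeleton `Lines/straindoor.lean` v2).

References: S. Palasek, arXiv:2605.13827 §4 [cite: Palasek2026ElementaryModel, §4]; M. Dashti, J. C. Robinson, SIAM
J. Numer. Anal. 46 (2008), Thm. 5 [cite: DashtiRobinson2008, Thm. 5]; H. Koch, N. Nadirashvili, G. Seregin, V. Šverák,
Acta Math. 203 (2009) §3 (3.5) [cite: KochNadirashviliSereginSverak2009, §3 (3.5) and §4 p. 8 (arXiv:0709.3599v1)];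
T. Tao, Anal. PDE 6 (2013), Thm. 5.4 [cite: Tao2011, Thm. 5.4 (ii)+(iv)].
-/

noncomputable section

namespace Summit.NavierStokesRegularity.FluidComputer.PalasekTowerClayBridge.StrainDoor

open Set MeasureTheory Metric Function InnerProductSpace
open scoped ENNReal NNReal ContDiff RealInnerProductSpace
open Literature.Analysis Literature.Analysis.FluidPDE

variable {R : TowerRates}

/-! ## §1 The currency-free core at `R` -/

/-- **THE CURRENCY-FREE CORE OF THE LINE at the rates `R`.** Let the mechanism door hold at `R`. Let `U` be smooth,
divergence free, `tsupport U ⊆ B̄(0, ρ)` (`ρ ≥ 0`), of speed `< Y₀(R)`; let `(v', q')` be ANY classical finite-energy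
FREE run (`ν = 1`) on the shifted window clock `[0, wfirstAt R]` with `v' 0 = U` — its existence supplied by the
caller in any currency — staying `δ`-close to a field `w` whose slice at `wfirstAt R` is continuous and shows, with
margins `η + δ` (`η > 0`), the cap `≤ (5/3)Y₁(R) − η − δ` on the window, the speed `≥ Y₁(R) + η + δ` at some
`‖x‖ ≤ ρ`, the finite-difference strain `(A₁(R) + η)‖x₁ − x₀‖ + 2δ < ‖w(x₁) − w(x₀)‖` in `B̄(0,ρ)` and a core loop of
circulation `≥ N₁(R)^{β−2} + η + δ·8π/N₁(R)`. Then `EpisodeBaseGAt R` (shift to `[1, τfirstAt R]`, `faces_of_near`, the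
door). [cite: Palasek2026ElementaryModel, §4] [cite: Tao2011, Thm. 5.4 (ii)+(iv)] -/
theorem episodeBaseGAt_of_mechanismDoorAt_of_nearFreeRun (hdoor : MechanismDoorAt R)
    {U : EuclideanSpace ℝ (Fin 3) → EuclideanSpace ℝ (Fin 3)} {ρ : ℝ}
    (hU : ContDiff ℝ ∞ U) (hUdiv : VectorCalculus.IsDivFree U) (hUsupp : tsupport U ⊆ closedBall 0 ρ)
    (hUlt : ∀ x, ‖U x‖ < R.Y 0) (hρ : 0 ≤ ρ)
    {v' w : ℝ → EuclideanSpace ℝ (Fin 3) → EuclideanSpace ℝ (Fin 3)} {q' : ℝ → EuclideanSpace ℝ (Fin 3) → ℝ}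
    {δ η : ℝ}
    (hv' : IsClassicalNSSolutionOn (Icc 0 (Host.wfirstAt R)) 1 0 v' q') (hv'0 : v' 0 = U)
    (hv'E : ∃ C : ℝ≥0∞, C < ⊤ ∧ ∀ t ∈ Icc 0 (Host.wfirstAt R), ∫⁻ x, ‖v' t x‖ₑ ^ 2 ≤ C)
    (hnear' : ∀ t ∈ Icc 0 (Host.wfirstAt R), ∀ x, ‖v' t x - w t x‖ ≤ δ)
    (hη : 0 < η) (hwc : Continuous (w (Host.wfirstAt R)))
    (hcap : ∀ t ∈ Icc 0 (Host.wfirstAt R), ∀ x, ‖w t x‖ ≤ 5 / 3 * R.Y 1 - η - δ)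
    (hspeed : ∃ x, ‖x‖ ≤ ρ ∧ R.Y 1 + η + δ ≤ ‖w (Host.wfirstAt R) x‖)
    (hstrain : ∃ x₀ x₁, ‖x₀‖ ≤ ρ ∧ ‖x₁‖ ≤ ρ ∧
      (R.A 1 + η) * ‖x₁ - x₀‖ + 2 * δ < ‖w (Host.wfirstAt R) x₁ - w (Host.wfirstAt R) x₀‖)
    (hcore : ∃ (x : EuclideanSpace ℝ (Fin 3)) (γ : ℝ → EuclideanSpace ℝ (Fin 3)),
      ‖x‖ ≤ ρ ∧ ContDiff ℝ 1 γ ∧ γ 0 = γ 1 ∧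
      (∀ s ∈ Icc (0 : ℝ) 1, γ s ∈ closedBall x (1 / R.N 1)) ∧
      (∀ s ∈ Icc (0 : ℝ) 1, ‖deriv γ s‖ ≤ 8 * Real.pi / R.N 1) ∧
      R.N 1 ^ (R.β - 2) + η + δ * (8 * Real.pi / R.N 1) ≤ circulation (w (Host.wfirstAt R)) γ) :
    EpisodeBaseGAt R := by
  set W : ℝ := Host.wfirstAt R with hW_def
  have hW : 0 < W := Host.wfirstAt_pos R
  have hτ : Host.τfirstAt R = 1 + W := Host.τfirstAt_eq R
  -- ### shift to the register clock `[1, τfirstAt R]`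
  have hmem : ∀ {t : ℝ}, t ∈ Icc (1 : ℝ) (Host.τfirstAt R) → t + -1 ∈ Icc 0 W := fun ht =>
    ⟨by linarith [ht.1], by rw [hτ] at ht; linarith [ht.2]⟩
  have hτ1 : Host.τfirstAt R + -1 = W := by rw [hτ]; ring
  have hv : IsClassicalNSSolutionOn (Icc 1 (Host.τfirstAt R)) 1 0 (fun t => v' (t + -1))
      (fun t => q' (t + -1)) := by
    have h := (hv'.comp_add_right (-1)).mono (fun t ht => hmem ht)
      (uniqueDiffOn_Icc (by rw [hτ]; linarith))
    have hz : (fun t : ℝ => (0 : ℝ → EuclideanSpace ℝ (Fin 3) → EuclideanSpace ℝ (Fin 3)) (t + -1)) = 0 := by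
      funext t; rfl
    rw [hz] at h
    exact h
  have hv1 : (fun t : ℝ => v' (t + -1)) 1 = U := by
    show v' (1 + -1) = U
    norm_num
    exact hv'0
  have hvE : ∃ C : ℝ≥0∞, C < ⊤ ∧
      ∀ t ∈ Icc (1 : ℝ) (Host.τfirstAt R), ∫⁻ x, ‖(fun t => v' (t + -1)) t x‖ₑ ^ 2 ≤ C := by
    obtain ⟨C, hC, hb⟩ := hv'E
    exact ⟨C, hC, fun t ht => hb (t + -1) (hmem ht)⟩
  have hnear : ∀ t ∈ Icc (1 : ℝ) (Host.τfirstAt R), ∀ x,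
      ‖(fun t => v' (t + -1)) t x - (fun t => w (t + -1)) t x‖ ≤ δ := fun t ht x =>
    hnear' (t + -1) (hmem ht) x
  have hwc' : Continuous ((fun t : ℝ => w (t + -1)) (Host.τfirstAt R)) := by
    show Continuous (w (Host.τfirstAt R + -1))
    rw [hτ1]; exact hwc
  have hcap' : ∀ t ∈ Icc (1 : ℝ) (Host.τfirstAt R), ∀ x,
      ‖(fun t : ℝ => w (t + -1)) t x‖ ≤ 5 / 3 * R.Y 1 - η - δ := fun t ht x =>
    hcap (t + -1) (hmem ht) x
  have hspeed' : ∃ x, ‖x‖ ≤ ρ ∧ R.Y 1 + η + δ ≤ ‖(fun t : ℝ => w (t + -1)) (Host.τfirstAt R) x‖ := by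
    show ∃ x, ‖x‖ ≤ ρ ∧ R.Y 1 + η + δ ≤ ‖w (Host.τfirstAt R + -1) x‖
    rw [hτ1]; exact hspeed
  have hstrain' : ∃ x₀ x₁, ‖x₀‖ ≤ ρ ∧ ‖x₁‖ ≤ ρ ∧
      (R.A 1 + η) * ‖x₁ - x₀‖ + 2 * δ <
        ‖(fun t : ℝ => w (t + -1)) (Host.τfirstAt R) x₁ - (fun t : ℝ => w (t + -1)) (Host.τfirstAt R) x₀‖ := by
    show ∃ x₀ x₁, ‖x₀‖ ≤ ρ ∧ ‖x₁‖ ≤ ρ ∧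
      (R.A 1 + η) * ‖x₁ - x₀‖ + 2 * δ < ‖w (Host.τfirstAt R + -1) x₁ - w (Host.τfirstAt R + -1) x₀‖
    rw [hτ1]; exact hstrain
  have hcore' : ∃ (x : EuclideanSpace ℝ (Fin 3)) (γ : ℝ → EuclideanSpace ℝ (Fin 3)),
      ‖x‖ ≤ ρ ∧ ContDiff ℝ 1 γ ∧ γ 0 = γ 1 ∧
      (∀ s ∈ Icc (0 : ℝ) 1, γ s ∈ closedBall x (1 / R.N 1)) ∧
      (∀ s ∈ Icc (0 : ℝ) 1, ‖deriv γ s‖ ≤ 8 * Real.pi / R.N 1) ∧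
      R.N 1 ^ (R.β - 2) + η + δ * (8 * Real.pi / R.N 1) ≤
        circulation ((fun t : ℝ => w (t + -1)) (Host.τfirstAt R)) γ := by
    show ∃ (x : EuclideanSpace ℝ (Fin 3)) (γ : ℝ → EuclideanSpace ℝ (Fin 3)),
      ‖x‖ ≤ ρ ∧ ContDiff ℝ 1 γ ∧ γ 0 = γ 1 ∧
      (∀ s ∈ Icc (0 : ℝ) 1, γ s ∈ closedBall x (1 / R.N 1)) ∧
      (∀ s ∈ Icc (0 : ℝ) 1, ‖deriv γ s‖ ≤ 8 * Real.pi / R.N 1) ∧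
      R.N 1 ^ (R.β - 2) + η + δ * (8 * Real.pi / R.N 1) ≤ circulation (w (Host.τfirstAt R + -1)) γ
    rw [hτ1]; exact hcore
  -- ### the four faces of the exact run with margin `η`, then the mechanism door
  obtain ⟨hcapv, hspeedv, hstrainv, hcorev⟩ :=
    faces_of_near (R := R) (ρ := ρ) hv hnear hwc' hcap' hspeed' hstrain' hcore'
  exact hdoor hU hUdiv hUsupp hUlt hρ hv hv1 hvE hη hcapv hspeedv hstrainv hcorev

/-! ## §2 The numeral strain certificate at `R` (slice constant `9.03`) -/

/-- **The data of ONE STRAIN CERTIFICATE at the rates `R`, NUMERAL VERSION**: the fields of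
`StrainDoor.CertificateData R` with `oseenSliceConst ℝ³` replaced by the numeral `9.03` in the short-window and
initial-layer inequalities — EXACTLY the hypotheses of the numeral strain-shadowed-run door
`StrainShadowSharp.exists_freeRun_near_of_strain` (p529071) on `[0, wfirstAt R]` — and the same four explicit readouts.
[cite: Palasek2026ElementaryModel, §4] [cite: DashtiRobinson2008, Thm. 5]
[cite: KochNadirashviliSereginSverak2009, §3 (3.5) and §4 p. 8 (arXiv:0709.3599v1)] -/
structure CertificateDataSharp (R : TowerRates)
    (U : EuclideanSpace ℝ (Fin 3) → EuclideanSpace ℝ (Fin 3)) (ρ : ℝ)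
    (w g : ℝ → EuclideanSpace ℝ (Fin 3) → EuclideanSpace ℝ (Fin 3)) (ϖ : ℝ → EuclideanSpace ℝ (Fin 3) → ℝ)
    (Γ : ℝ → ℝ) (Bw Gb G₂ D E₀ h δ η : ℝ) : Prop where
  /-- the datum is smooth … -/
  datum_smooth : ContDiff ℝ ∞ U
  /-- … divergence free … -/
  datum_divFree : VectorCalculus.IsDivFree U
  /-- … supported in the readout ball `B̄(0, ρ)` … -/
  datum_support : tsupport U ⊆ closedBall 0 ρ
  /-- … of speed below the level-`0` scale `Y₀(R)` (the anchor) -/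
  datum_lt : ∀ x, ‖U x‖ < R.Y 0
  /-- the readout radius is a genuine radius -/
  radius_nonneg : 0 ≤ ρ
  /-- THE REFERENCE RUN: `(w, ϖ)` is a classical solution at unit viscosity on the shifted window clock
  `[0, wfirstAt R]`, FORCED BY ITS (Leray-projected) DEFECT `g` -/
  run : IsClassicalNSSolutionOn (Icc 0 (Host.wfirstAt R)) 1 g w ϖ
  /-- the defect is jointly continuous … -/
  defect_cont : Continuous (uncurry g)
  /-- … bounded … -/
  defect_bdd : ∀ τ ∈ Icc 0 (Host.wfirstAt R), ∀ y, ‖g τ y‖ ≤ Gb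
  /-- … weakly divergence free (Leray-projected) … -/
  defect_divFree : ∀ τ ∈ Icc 0 (Host.wfirstAt R), IsWeaklyDivFree (g τ)
  /-- … and of `L²` size `≤ G₂`, `G₂ ≥ 0` -/
  G₂_nonneg : 0 ≤ G₂
  defect_two : ∀ τ ∈ Icc 0 (Host.wfirstAt R), eLpNorm (g τ) 2 volume ≤ ENNReal.ofReal G₂
  /-- finite energy of the reference, uniformly on the window -/
  energy : ∃ C : ℝ≥0∞, C < ⊤ ∧ ∀ t ∈ Icc 0 (Host.wfirstAt R), ∫⁻ x, ‖w t x‖ₑ ^ 2 ≤ C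
  /-- Tao's `L²`-Sobolev class: the reference … -/
  sobolev : HasBoundedSobolevNormsOn (Icc 0 (Host.wfirstAt R)) w
  /-- … its time derivative … -/
  sobolev_t : HasBoundedSobolevNormsOn (Icc 0 (Host.wfirstAt R))
    (FluidPDE.timeDerivWithin (Icc 0 (Host.wfirstAt R)) w)
  /-- … and its pressure -/
  pressure : ∀ n : ℕ, ∃ C' : ℝ≥0, ∀ t ∈ Icc 0 (Host.wfirstAt R),
    ∫⁻ x, ‖iteratedFDeriv ℝ n (ϖ t) x‖ₑ ^ 2 ≤ C'
  /-- the speed bound of the reference, `B_w > 0` -/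
  Bw_pos : 0 < Bw
  speed_bdd : ∀ t ∈ Icc 0 (Host.wfirstAt R), ∀ y, ‖w t y‖ ≤ Bw
  /-- THE STRAIN MAJORANT: `Γ ≥ 0` continuous dominates the maximal compression rate of the reference -/
  Γ_cont : ContinuousOn Γ (Icc 0 (Host.wfirstAt R))
  Γ_nonneg : ∀ t ∈ Icc 0 (Host.wfirstAt R), 0 ≤ Γ t
  strain : ∀ t ∈ Icc 0 (Host.wfirstAt R), ∀ x ξ, -⟪ξ, fderiv ℝ (w t) x ξ⟫ ≤ Γ t * ‖ξ‖ ^ 2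
  /-- the datum defect in sup norm … -/
  datum_sup : ∀ y, ‖w 0 y - U y‖ ≤ D
  /-- … and in `L²` (`E₀ ≥ 0`) -/
  E₀_nonneg : 0 ≤ E₀
  datum_two : ∫ x, ‖U x - w 0 x‖ ^ 2 ≤ E₀ ^ 2
  /-- the terminal smoothing window `h > 0` is SHORT for the sup-norm theory (NUMERAL threshold) -/
  h_pos : 0 < h
  h_short : (24 * (9.03 : ℝ) * (Bw + 1 + Bw)) ^ 2 * h ≤ 1
  /-- the tolerance: `δ ≤ 1/2`, the initial-layer inequality (NUMERAL) and the window inequality of p529071 -/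
  δ_le : δ ≤ 1 / 2
  δ_layer : 2 * (D + 4 * h ^ (1 / 4 : ℝ) * G₂) * Real.exp (36 * (9.03 : ℝ) ^ 2 * (Bw + 1 + Bw) ^ 2 * h) ≤ δ
  δ_window : 2 * ((E₀ + G₂ * Host.wfirstAt R) * Real.exp (∫ s in (0 : ℝ)..Host.wfirstAt R, Γ s) +
    4 * G₂ * h) * h ^ (-(3 / 4 : ℝ)) ≤ δ
  /-- the margin of the readouts -/
  η_pos : 0 < η
  /-- the readout slice of the reference is continuous -/
  slice_cont : Continuous (w (Host.wfirstAt R))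
  /-- READOUT 1 — the cap with margin `η + δ` on the whole window -/
  cap : ∀ t ∈ Icc 0 (Host.wfirstAt R), ∀ x, ‖w t x‖ ≤ 5 / 3 * R.Y 1 - η - δ
  /-- READOUT 2 — the speed floor with margin `η + δ` inside the readout ball -/
  speed : ∃ x, ‖x‖ ≤ ρ ∧ R.Y 1 + η + δ ≤ ‖w (Host.wfirstAt R) x‖
  /-- READOUT 3 — the strain floor by a finite difference inside the readout ball -/
  strainFD : ∃ x₀ x₁, ‖x₀‖ ≤ ρ ∧ ‖x₁‖ ≤ ρ ∧
    (R.A 1 + η) * ‖x₁ - x₀‖ + 2 * δ < ‖w (Host.wfirstAt R) x₁ - w (Host.wfirstAt R) x₀‖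
  /-- READOUT 4 — the core loop with margin `η + δ · 8π/N₁` -/
  core : ∃ (x : EuclideanSpace ℝ (Fin 3)) (γ : ℝ → EuclideanSpace ℝ (Fin 3)),
    ‖x‖ ≤ ρ ∧ ContDiff ℝ 1 γ ∧ γ 0 = γ 1 ∧
    (∀ s ∈ Icc (0 : ℝ) 1, γ s ∈ closedBall x (1 / R.N 1)) ∧
    (∀ s ∈ Icc (0 : ℝ) 1, ‖deriv γ s‖ ≤ 8 * Real.pi / R.N 1) ∧
    R.N 1 ^ (R.β - 2) + η + δ * (8 * Real.pi / R.N 1) ≤ circulation (w (Host.wfirstAt R)) γ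

/-- **ONE STRAIN CERTIFICATE at the rates `R`, NUMERAL VERSION** (open `Prop`, the mechanism, in the letter a
computation checks): SOME datum, reference run and numbers filling `CertificateDataSharp R`.
[cite: Palasek2026ElementaryModel, §4] -/
def CertificateSharpAt (R : TowerRates) : Prop :=
  ∃ (U : EuclideanSpace ℝ (Fin 3) → EuclideanSpace ℝ (Fin 3)) (ρ : ℝ)
    (w g : ℝ → EuclideanSpace ℝ (Fin 3) → EuclideanSpace ℝ (Fin 3)) (ϖ : ℝ → EuclideanSpace ℝ (Fin 3) → ℝ)
    (Γ : ℝ → ℝ) (Bw Gb G₂ D E₀ h δ η : ℝ), CertificateDataSharp R U ρ w g ϖ Γ Bw Gb G₂ D E₀ h δ η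

/-- **THE NUMERAL STRAIN DOOR AT `R`, COMPOSED**: the mechanism door at `R` and the data of one numeral strain
certificate at `R` give `EpisodeBaseGAt R` (numeral door `StrainShadowSharp.exists_freeRun_near_of_strain`, p529071,
then `episodeBaseGAt_of_mechanismDoorAt_of_nearFreeRun`). [cite: Palasek2026ElementaryModel, §4]
[cite: DashtiRobinson2008, Thm. 5] [cite: Tao2011, Thm. 5.4 (ii)+(iv)] -/
theorem episodeBaseGAt_of_mechanismDoorAt_of_certificateDataSharp (hdoor : MechanismDoorAt R)
    {U : EuclideanSpace ℝ (Fin 3) → EuclideanSpace ℝ (Fin 3)} {ρ : ℝ}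
    {w g : ℝ → EuclideanSpace ℝ (Fin 3) → EuclideanSpace ℝ (Fin 3)} {ϖ : ℝ → EuclideanSpace ℝ (Fin 3) → ℝ}
    {Γ : ℝ → ℝ} {Bw Gb G₂ D E₀ h δ η : ℝ} (c : CertificateDataSharp R U ρ w g ϖ Γ Bw Gb G₂ D E₀ h δ η) :
    EpisodeBaseGAt R := by
  have hUc : HasCompactSupport U :=
    IsCompact.of_isClosed_subset (isCompact_closedBall (0 : EuclideanSpace ℝ (Fin 3)) ρ)
      (isClosed_tsupport U) c.datum_support
  obtain ⟨v', q', hv', hv'0, hv'E, hnear'⟩ :=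
    StrainShadowSharp.exists_freeRun_near_of_strain (Host.wfirstAt_pos R) c.run c.defect_cont c.defect_bdd
      c.defect_divFree c.G₂_nonneg c.defect_two c.energy c.sobolev c.sobolev_t c.pressure c.Bw_pos c.speed_bdd
      c.Γ_cont c.Γ_nonneg c.strain c.datum_smooth hUc c.datum_divFree c.datum_sup c.E₀_nonneg c.datum_two c.h_pos
      c.h_short c.δ_le c.δ_layer c.δ_window
  exact episodeBaseGAt_of_mechanismDoorAt_of_nearFreeRun hdoor c.datum_smooth c.datum_divFree c.datum_support
    c.datum_lt c.radius_nonneg hv' hv'0 hv'E hnear' c.η_pos c.slice_cont c.cap c.speed c.strainFD c.core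

/-- **THE NUMERAL STRAIN DOOR AT `R`**: `MechanismDoorAt R → CertificateSharpAt R → EpisodeBaseGAt R` — the shape of the
skeleton `Cruxes/EpisodeBaseT/Lines/straindoor.lean` v2 (`R = TowerRates.tuned`, `EpisodeBaseGAt tuned = EpisodeBaseT` by
`Iff.rfl`). [cite: Palasek2026ElementaryModel, §4] -/
theorem episodeBaseGAt_of_mechanismDoorAt_of_certificateSharpAt (hdoor : MechanismDoorAt R)
    (hcert : CertificateSharpAt R) : EpisodeBaseGAt R := by
  obtain ⟨U, ρ, w, g, ϖ, Γ, Bw, Gb, G₂, D, E₀, h, δ, η, c⟩ := hcert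
  exact episodeBaseGAt_of_mechanismDoorAt_of_certificateDataSharp hdoor c

end Summit.NavierStokesRegularity.FluidComputer.PalasekTowerClayBridge.StrainDoor

end
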